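import Mathlib.Analysis.SpecificLimits.Normed
import Literature.Computability.AlgebraicComplexity.RazElusiveGeneral
import Literature.Computability.AlgebraicComplexity.ArithCircuitProofs
import HarnessLib

/-!
# `RazElusiveGeneral`: proofs

Companion (proofs only, no new facts) to `RazElusiveGeneral.lean`.

## Part 1 — `raz_elusive_curve` carries no explicitness

Certifies the `## Correction` note of `RazElusiveGeneral.lean`. Raz (2010, remark after
Def. 1.3, p. 142) stresses that poly(`n`)-definability of a polynomial mapping `f : Fⁿ → F^m`
bounds the defining circuit polynomially in `n` and NOT in `m`. We prove the elementary converse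
observation: as soon as the arity `m(n)`, the degrees and the circuit complexities of the
coordinates are all polynomially bounded in the index `n`, the family is poly(`n`)-definable in
the sense of `IsPolyDefinableMap` with an EMPTY Boolean sum (`ℓ = 0`), via the selector
polynomial `g = Σ_{i < m} f_i · Π_{t < k} (w_t if bit_t(i) = 1 else 1 - w_t)`, `k = ⌈log₂ m⌉`
(`selectorPoly`, `isPolyDefinableMap_of_isPBounded`). For curve families indexed by their own
arity (`m := id`, one variable) the complexity bound follows from the degree bound
(`complexity_le_of_totalDegree_le`: a univariate polynomial of degree `≤ D` has circuit
complexity `≤ (D + 1)(D + 2)`, by summing monomials), so the explicitness clause of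
`raz_elusive_curve` is implied by its degree clause
(`isPolyDefinableMap_id_of_isPBounded_totalDegree`), and
`raz_elusive_curve` is equivalent to the explicitness-free implication
"(∃ polynomial-degree curve family, eventually `(m-1,2)`-elusive) → `PER ∉ VP_ℂ`"
(`raz_elusive_curve_iff`). Everything in Part 1 is folklore bookkeeping over the tree's circuit
model (`complexity`, Bürgisser 2000, Def. 2.1); nothing is cited as a result of Raz.

## Part 2 — the abstract's curve statement from the printed Cor. 5.8

`Raz2010_elusive_curve_of_cor_5_8 : Raz2010_cor_5_8 F → Raz2010_elusive_curve F`: the corrected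
curve statement of `RazElusiveGeneral.lean` follows from the numbered Corollary 5.8 (= 1.14)
alone, by making Raz's parameters explicit: an eventually `(m-1, 2)`-elusive curve of degree
`< 2ⁿ` has `m ≤ 2ⁿ` (`le_of_isElusive_of_totalDegree_lt`, a linear-algebra remark), so the
least rank `r ≥ 3` with `C(n+r-1, r) ≥ m` satisfies `r ≤ n` (`two_pow_le_choose_multiset_self`)
and `r → ∞` (`rank_eventually_ge`); the multilinearised curve (Prop. 1.2) padded to
`C(n+r-1, r)` coordinates by Raz's own formula `i ↦ Σ_e g(x, e, bits i)` stays
poly(`n`)-definable with the same `g` (`bitSubst_rename_castLE`) and stays elusive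
(`IsElusive.of_comp`); and with `s = m - 1` the minimality of `r` yields the growth hypothesis
`s / C(n+r'-1, r') ≥ n^{ω(1)}`, `r' = ⌊2r/3⌋`, of Cor. 5.8 (`rank_growth`, elementary
estimates on the multiset binomials `C(n+j-1, j)` plus "polynomial < exponential",
`eventually_mul_pow_lt_two_pow`, from Mathlib's `tendsto_pow_const_div_const_pow_of_one_lt`).

## References

* R. Raz, *Elusive functions and lower bounds for arithmetic circuits*, Theory of Computing 6
  (2010) 135–177, Def. 1.3 and the remark following it (p. 142); Prop. 1.2; p. 137; Cor. 5.8
  (p. 172) = Cor. 1.14 (p. 147).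
* P. Bürgisser, *Completeness and Reduction in Algebraic Complexity Theory* (2000), Def. 2.1.
-/

noncomputable section

open MvPolynomial

namespace Literature.Computability.AlgebraicComplexity

universe u v

/-! ### The bit-selector polynomial -/

section Selector

variable {k : Type u} [CommRing k]

/-- The indicator of the bit pattern of `i` on `K` Boolean variables `w_0, …, w_{K-1}` (the
right summand of the variable type): `Π_{t<K} (w_t if bit_t(i) = 1 else 1 - w_t)`. On a bit
vector `w = bits(j)` it evaluates to `1` if `i ≡ j (mod 2^K)` and to `0` otherwise. [folklore] -/
def bitIndicator (τ : Type v) (K : ℕ) (i : ℕ) : MvPolynomial (τ ⊕ Fin K) k :=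
  ∏ t : Fin K, if i.testBit t then X (Sum.inr t) else 1 - X (Sum.inr t)

/-- The selector polynomial of a tuple `f = (f_0, …, f_{m-1})`: `Σ_i f_i(x) · bitIndicator i (w)`
in the variables `(x ⊕ (no e's)) ⊕ w` of `IsPolyDefinableMap` with `ℓ = 0`. [folklore] -/
def selectorPoly {σ : Type v} {m : ℕ} (K : ℕ) (f : Fin m → MvPolynomial σ k) :
    MvPolynomial ((σ ⊕ Fin 0) ⊕ Fin K) k :=
  ∑ i : Fin m, rename (Sum.inl ∘ Sum.inl) (f i) * bitIndicator (σ ⊕ Fin 0) K i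

/-- Substituting the bits of `j` for `w` in `bitIndicator i`: the result is `1` if `i` and `j`
have the same first `K` bits and `0` otherwise. [folklore] -/
theorem aeval_bits_bitIndicator {τ : Type v} (K i j : ℕ) :
    aeval (Sum.elim X fun t : Fin K => if j.testBit t then (1 : MvPolynomial τ k) else 0)
        (bitIndicator (k := k) τ K i) =
      if ∀ t : Fin K, i.testBit t = j.testBit t then 1 else 0 := by
  classical
  unfold bitIndicator
  rw [map_prod]
  by_cases h : ∀ t : Fin K, i.testBit t = j.testBit t
  · rw [if_pos h]
    refine Finset.prod_eq_one fun t _ => ?_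
    by_cases hi : i.testBit t <;> simp [hi, ← h t]
  · rw [if_neg h]
    push Not at h
    obtain ⟨t, ht⟩ := h
    refine Finset.prod_eq_zero (Finset.mem_univ t) ?_
    by_cases hi : i.testBit t
    · have hj : j.testBit t = false := by simpa [hi] using (Ne.symm ht)
      simp [hi, hj]
    · have hj : j.testBit t = true := by
        cases h' : j.testBit t <;> simp_all
      simp [hi, hj]

/-- Two numbers below `2^K` with the same first `K` bits are equal. [folklore] -/
theorem eq_of_testBit_eq_of_lt {K i j : ℕ} (hi : i < 2 ^ K) (hj : j < 2 ^ K)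
    (h : ∀ t : Fin K, i.testBit t = j.testBit t) : i = j := by
  refine Nat.eq_of_testBit_eq fun t => ?_
  by_cases ht : t < K
  · exact h ⟨t, ht⟩
  · have h2 : 2 ^ K ≤ 2 ^ t := Nat.pow_le_pow_right (by norm_num) (not_lt.1 ht)
    rw [Nat.testBit_lt_two_pow (lt_of_lt_of_le hi h2),
      Nat.testBit_lt_two_pow (lt_of_lt_of_le hj h2)]

/-- Substituting the bits of `j` in `bitIndicator i` gives `1` if `i = j` and `0` otherwise,
for `i, j < 2^K`. [folklore] -/
theorem aeval_bits_bitIndicator_of_lt {τ : Type v} {K i j : ℕ} (hi : i < 2 ^ K)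
    (hj : j < 2 ^ K) :
    aeval (Sum.elim X fun t : Fin K => if j.testBit t then (1 : MvPolynomial τ k) else 0)
        (bitIndicator (k := k) τ K i) =
      if i = j then 1 else 0 := by
  rw [aeval_bits_bitIndicator]
  by_cases hij : i = j
  · simp [hij]
  · rw [if_neg hij, if_neg]
    exact fun h => hij (eq_of_testBit_eq_of_lt hi hj h)

/-- The `x`-part is untouched by the bit substitution: a polynomial in the `x`-variables,
transported to `(x ⊕ e) ⊕ w`, is mapped to itself transported to `x ⊕ e`. [folklore] -/
theorem aeval_sumElim_rename_inl_inl {σ : Type v} {ℓ K : ℕ} (b : Fin K → MvPolynomial (σ ⊕ Fin ℓ) k)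
    (p : MvPolynomial σ k) :
    aeval (Sum.elim X b) (rename (Sum.inl ∘ Sum.inl) p) =
      (rename Sum.inl p : MvPolynomial (σ ⊕ Fin ℓ) k) := by
  rw [aeval_rename, rename_eq_aeval]
  rfl

/-- **Selection.** Substituting the bits of `j < m ≤ 2^K` for `w` in the selector polynomial of
`f` returns `f_j` (transported to the variables `x ⊕ (no e's)`). [folklore] -/
theorem aeval_bits_selectorPoly {σ : Type v} {m K : ℕ} (hm : m ≤ 2 ^ K)
    (f : Fin m → MvPolynomial σ k) (j : Fin m) :
    aeval (Sum.elim X fun t : Fin K => if (j : ℕ).testBit t then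
        (1 : MvPolynomial (σ ⊕ Fin 0) k) else 0) (selectorPoly K f) =
      rename Sum.inl (f j) := by
  unfold selectorPoly
  rw [map_sum, Finset.sum_eq_single j]
  · rw [map_mul, aeval_sumElim_rename_inl_inl,
      aeval_bits_bitIndicator_of_lt (lt_of_lt_of_le j.2 hm) (lt_of_lt_of_le j.2 hm), if_pos rfl,
      mul_one]
  · intro i _ hij
    rw [map_mul, aeval_bits_bitIndicator_of_lt (lt_of_lt_of_le i.2 hm) (lt_of_lt_of_le j.2 hm),
      if_neg (fun h => hij (Fin.ext h)), mul_zero]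
  · intro h
    exact absurd (Finset.mem_univ j) h

/-- An empty Boolean sum (`ℓ = 0`) of a polynomial in the `x`-variables only is that
polynomial. [folklore] -/
theorem boolSum_rename_inl_zero {σ : Type v} (p : MvPolynomial σ k) :
    boolSum (m := 0) (rename Sum.inl p) = p := by
  simp [boolSum, aeval_rename, aeval_X_left_apply]

/-! ### Degree and complexity of the selector polynomial -/

/-- Each factor of `bitIndicator` has total degree `≤ 1`. [folklore] -/
theorem totalDegree_bitIndicator_factor_le {τ : Type v} (K i : ℕ) (t : Fin K) :
    (if i.testBit t then X (Sum.inr t) else 1 - X (Sum.inr t) :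
        MvPolynomial (τ ⊕ Fin K) k).totalDegree ≤ 1 := by
  have hX : (X (Sum.inr t) : MvPolynomial (τ ⊕ Fin K) k).totalDegree ≤ 1 :=
    (totalDegree_monomial_le _ _).trans (by simp)
  split_ifs
  · exact hX
  · exact (totalDegree_sub _ _).trans (max_le (by simp) hX)

/-- `bitIndicator` has total degree `≤ K`. [folklore] -/
theorem totalDegree_bitIndicator_le {τ : Type v} (K i : ℕ) :
    (bitIndicator (k := k) τ K i).totalDegree ≤ K := by
  unfold bitIndicator
  refine (totalDegree_finsetProd _ _).trans ?_
  calc ∑ t : Fin K, (if i.testBit t then X (Sum.inr t) else 1 - X (Sum.inr t) :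
          MvPolynomial (τ ⊕ Fin K) k).totalDegree
      ≤ ∑ _t : Fin K, 1 := Finset.sum_le_sum fun t _ => totalDegree_bitIndicator_factor_le K i t
    _ = K := by simp

/-- Degree of the selector polynomial: at most (max degree of the `f_i`) `+ K`. [folklore] -/
theorem totalDegree_selectorPoly_le {σ : Type v} {m : ℕ} (K : ℕ) (f : Fin m → MvPolynomial σ k) :
    (selectorPoly K f).totalDegree ≤ (Finset.univ.sup fun i => (f i).totalDegree) + K := by
  unfold selectorPoly
  refine (totalDegree_finsetSum _ _).trans (Finset.sup_le fun i _ => ?_)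
  calc (rename (Sum.inl ∘ Sum.inl) (f i) * bitIndicator (σ ⊕ Fin 0) K i).totalDegree
      ≤ (rename (Sum.inl ∘ Sum.inl) (f i)).totalDegree +
          (bitIndicator (k := k) (σ ⊕ Fin 0) K i).totalDegree := totalDegree_mul _ _
    _ ≤ (f i).totalDegree + K :=
        Nat.add_le_add (totalDegree_rename_le _ _) (totalDegree_bitIndicator_le K i)
    _ ≤ (Finset.univ.sup fun i => (f i).totalDegree) + K :=
        Nat.add_le_add_right (Finset.le_sup (f := fun i => (f i).totalDegree)
          (Finset.mem_univ i)) K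

/-- Each factor of `bitIndicator` has circuit complexity `≤ 2` (`1 - w = C 1 + (-1) • w`:
one scalar gate and one sum gate; variables and constants are free). [folklore] -/
theorem complexity_bitIndicator_factor_le {τ : Type v} (K i : ℕ) (t : Fin K) :
    complexity (if i.testBit t then X (Sum.inr t) else 1 - X (Sum.inr t) :
        MvPolynomial (τ ⊕ Fin K) k) ≤ 2 := by
  split_ifs
  · rw [complexity_X_holds]; exact Nat.zero_le _
  · have h1 : (1 - X (Sum.inr t) : MvPolynomial (τ ⊕ Fin K) k) =
        C 1 + (-1 : k) • X (Sum.inr t) := by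
      rw [neg_one_smul, C_1, sub_eq_add_neg]
    rw [h1]
    calc complexity (C 1 + (-1 : k) • X (Sum.inr t) : MvPolynomial (τ ⊕ Fin K) k)
        ≤ complexity (C 1 : MvPolynomial (τ ⊕ Fin K) k) +
            complexity ((-1 : k) • X (Sum.inr t) : MvPolynomial (τ ⊕ Fin K) k) + 1 :=
          complexity_add_le_holds _ _
      _ ≤ 0 + (0 + 1) + 1 := by
          gcongr
          · exact (complexity_C_holds (σ := τ ⊕ Fin K) (1 : k)).le
          · exact (complexity_smul_le_holds _ _).trans (by rw [complexity_X_holds])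
      _ = 2 := rfl

/-- `bitIndicator` has circuit complexity `≤ 3K`. [folklore] -/
theorem complexity_bitIndicator_le {τ : Type v} (K i : ℕ) :
    complexity (bitIndicator (k := k) τ K i) ≤ 3 * K := by
  unfold bitIndicator
  refine (complexity_finset_prod_le _ _).trans ?_
  calc ∑ t : Fin K, complexity (if i.testBit t then X (Sum.inr t) else 1 - X (Sum.inr t) :
          MvPolynomial (τ ⊕ Fin K) k) + (Finset.univ : Finset (Fin K)).card
      ≤ ∑ _t : Fin K, 2 + (Finset.univ : Finset (Fin K)).card :=
        Nat.add_le_add_right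
          (Finset.sum_le_sum fun t _ => complexity_bitIndicator_factor_le K i t) _
    _ = 3 * K := by simp; ring

/-- Complexity of the selector polynomial: with `L` a bound on the complexities of the `f_i`,
at most `m · (L + 3K + 2)`. [folklore] -/
theorem complexity_selectorPoly_le {σ : Type v} {m : ℕ} (K : ℕ) (f : Fin m → MvPolynomial σ k)
    {L : ℕ} (hL : ∀ i, complexity (f i) ≤ L) :
    complexity (selectorPoly K f) ≤ m * (L + 3 * K + 2) := by
  unfold selectorPoly
  refine (complexity_finset_sum_le _ _).trans ?_
  calc ∑ i : Fin m, complexity (rename (Sum.inl ∘ Sum.inl) (f i) * bitIndicator (σ ⊕ Fin 0) K i) +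
          (Finset.univ : Finset (Fin m)).card
      ≤ ∑ _i : Fin m, (L + 3 * K + 1) + (Finset.univ : Finset (Fin m)).card := by
        refine Nat.add_le_add_right (Finset.sum_le_sum fun i _ => ?_) _
        calc complexity (rename (Sum.inl ∘ Sum.inl) (f i) * bitIndicator (σ ⊕ Fin 0) K i)
            ≤ complexity (rename (Sum.inl ∘ Sum.inl) (f i)) +
                complexity (bitIndicator (k := k) (σ ⊕ Fin 0) K i) + 1 :=
              complexity_mul_le_holds _ _
          _ ≤ L + 3 * K + 1 :=
              Nat.add_le_add_right (Nat.add_le_add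
                ((complexity_rename_le_holds' _ _).trans (hL i))
                (complexity_bitIndicator_le K i)) 1
    _ = m * (L + 3 * K + 2) := by simp; ring

end Selector

/-! ### Univariate polynomials of degree `D` have complexity `O(D²)` -/

section Univariate

variable {k : Type u} [CommRing k]

/-- A one-variable polynomial of total degree `≤ D` is the sum of its `D + 1` first monomials.
[folklore] -/
theorem eq_sum_range_of_totalDegree_le (p : MvPolynomial (Fin 1) k) {D : ℕ}
    (hD : p.totalDegree ≤ D) :
    p = ∑ j ∈ Finset.range (D + 1), C (coeff (Finsupp.single 0 j) p) * X 0 ^ j := by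
  classical
  ext v
  obtain ⟨j₀, rfl⟩ : ∃ j₀, v = Finsupp.single 0 j₀ :=
    ⟨v 0, Finsupp.unique_ext (by rw [Fin.default_eq_zero, Finsupp.single_eq_same])⟩
  rw [coeff_sum]
  simp_rw [X_pow_eq_monomial, C_mul_monomial, mul_one, coeff_monomial,
    (Finsupp.single_injective _).eq_iff, Finset.sum_ite_eq', Finset.mem_range]
  split_ifs with h
  · rfl
  · rw [← notMem_support_iff]
    intro hs
    have := le_totalDegree hs
    rw [Finsupp.sum_single_index rfl] at this
    omega

/-- The monomial `c · x^j` has circuit complexity `≤ j + 1` (`j` product gates for `x^j`, one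
for the constant; constants and variables are free). [folklore] -/
theorem complexity_C_mul_X_pow_le {σ : Type v} (c : k) (v : σ) (j : ℕ) :
    complexity (C c * X v ^ j : MvPolynomial σ k) ≤ j + 1 := by
  have hpow : complexity (X v ^ j : MvPolynomial σ k) ≤ j := by
    rw [Finset.pow_eq_prod_const]
    refine (complexity_finset_prod_le _ _).trans ?_
    rw [Finset.sum_eq_zero fun _ _ => complexity_X_holds (k := k) (σ := σ) v, Finset.card_range,
      zero_add]
  calc complexity (C c * X v ^ j : MvPolynomial σ k)
      ≤ complexity (C c : MvPolynomial σ k) + complexity (X v ^ j : MvPolynomial σ k) + 1 :=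
        complexity_mul_le_holds _ _
    _ ≤ 0 + j + 1 := by
        gcongr
        exact (complexity_C_holds (σ := σ) c).le
    _ = j + 1 := by ring

/-- **Univariate complexity bound.** A one-variable polynomial of total degree `≤ D` has circuit
complexity `≤ (D + 1) * (D + 2)` (sum of its monomials; Bürgisser 2000, §2.1). [folklore] -/
theorem complexity_le_of_totalDegree_le (p : MvPolynomial (Fin 1) k) {D : ℕ}
    (hD : p.totalDegree ≤ D) : complexity p ≤ (D + 1) * (D + 2) := by
  rw [eq_sum_range_of_totalDegree_le p hD]
  refine (complexity_finset_sum_le _ _).trans ?_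
  rw [Finset.card_range]
  calc ∑ j ∈ Finset.range (D + 1), complexity (C (coeff (Finsupp.single 0 j) p) * X 0 ^ j :
          MvPolynomial (Fin 1) k) + (D + 1)
      ≤ ∑ _j ∈ Finset.range (D + 1), (D + 1) + (D + 1) := by
        refine Nat.add_le_add_right (Finset.sum_le_sum fun j hj => ?_) _
        exact (complexity_C_mul_X_pow_le _ _ _).trans
          (Nat.succ_le_succ (Nat.lt_succ_iff.1 (Finset.mem_range.1 hj)))
    _ = (D + 1) * (D + 2) := by rw [Finset.sum_const, Finset.card_range]; ring

end Univariate

/-! ### Poly-definability with an empty Boolean sum -/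

section PolyDefinable

variable {k : Type u} [CommRing k]

/-- `⌈log₂ x⌉ ≤ x`. [folklore] -/
theorem clog_two_le_self (x : ℕ) : Nat.clog 2 x ≤ x :=
  (Nat.clog_le_iff_le_pow one_lt_two).2 Nat.lt_two_pow_self.le

/-- **With the arity `m`, the degrees and the coordinate complexities all poly(`n`), Def. 1.3
holds with `ℓ = 0`** (cf. Raz 2010, remark after Def. 1.3, p. 142: the definition has content
because `m` may be super-polynomial in `n` while `g` stays poly(`n`)): if the arity `m n`, the
degrees and the circuit complexities of the coordinates `f n i` are all polynomially bounded in
the index `n`, then `f` is poly(`n`)-definable (`IsPolyDefinableMap`) — with `ℓ = 0` and the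
selector polynomial as `g`. (With `m = poly(n)` alone Def. 1.3 still asks for uniform
`VNP`-type definability of the coordinates; it is void only for polynomial-degree univariate
families, `isPolyDefinableMap_id_of_isPBounded_totalDegree`.) [folklore] -/
theorem isPolyDefinableMap_of_isPBounded {σ : ℕ → Type v} {m : ℕ → ℕ}
    (f : ∀ n, Fin (m n) → MvPolynomial (σ n) k) (hm : IsPBounded m)
    (hdeg : IsPBounded fun n => Finset.univ.sup fun i : Fin (m n) => (f n i).totalDegree)
    (hL : IsPBounded fun n => Finset.univ.sup fun i : Fin (m n) => complexity (f n i)) :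
    IsPolyDefinableMap f := by
  have hK : IsPBounded fun n => Nat.clog 2 (m n) := hm.mono fun n => clog_two_le_self (m n)
  refine ⟨fun _ => 0, fun n => selectorPoly (Nat.clog 2 (m n)) (f n), IsPBounded.const 0,
    ?_, ?_, ?_⟩
  · exact (IsPBounded.add_holds hdeg hK).mono fun n => totalDegree_selectorPoly_le _ _
  · refine (IsPBounded.mul_holds hm (IsPBounded.add_holds (IsPBounded.add_holds hL
      (IsPBounded.mul_holds (IsPBounded.const 3) hK)) (IsPBounded.const 2))).mono fun n => ?_
    exact complexity_selectorPoly_le _ _ fun i =>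
      Finset.le_sup (f := fun i => complexity (f n i)) (Finset.mem_univ i)
  · intro n i
    unfold bitSubst
    rw [aeval_bits_selectorPoly (Nat.le_pow_clog one_lt_two _) (f n) i, boolSum_rename_inl_zero]

/-- **Curves indexed by their arity are automatically "explicit" in the sense of
`raz_elusive_curve`:** for a family of curves `f m : Fin m → k[x]` (one variable, `m` outputs,
indexed by `m` itself), a polynomial bound on the degrees alone gives
`IsPolyDefinableMap (m := id) (σ := fun _ => Fin 1) f`. [folklore] -/
theorem isPolyDefinableMap_id_of_isPBounded_totalDegree (f : ∀ m : ℕ, Fin m → MvPolynomial (Fin 1) k)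
    (hdeg : IsPBounded fun m => Finset.univ.sup fun i : Fin m => (f m i).totalDegree) :
    IsPolyDefinableMap (m := id) (σ := fun _ => Fin 1) f := by
  refine isPolyDefinableMap_of_isPBounded (m := id) f IsPBounded.id hdeg ?_
  refine (IsPBounded.mul_holds (IsPBounded.add_holds hdeg (IsPBounded.const 1))
    (IsPBounded.add_holds hdeg (IsPBounded.const 2))).mono fun n => Finset.sup_le fun i _ => ?_
  exact complexity_le_of_totalDegree_le (f n i)
    (Finset.le_sup (f := fun i => (f n i).totalDegree) (Finset.mem_univ i))

end PolyDefinable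

/-! ### `raz_elusive_curve` without its (void) explicitness clause -/

/-- **`raz_elusive_curve` is explicitness-free.** The tree's `raz_elusive_curve` is equivalent
to: "if SOME family of curves `f m : ℂ → ℂ^m` of degree polynomial in `m` is `(m-1, 2)`-elusive
for all large `m`, then the permanent family over `ℂ` is not a `VP` family" — its
`IsPolyDefinableMap (m := id)` clause follows from its degree clause
(`isPolyDefinableMap_id_of_isPBounded_totalDegree`). This is why it is not Raz's theorem
(Raz 2010, Cor. 5.8, vendored as `Raz2010_cor_5_8`): there explicitness is polynomial in a
parameter `n` with `m = n^{ω(1)}`. [folklore] -/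
theorem raz_elusive_curve_iff :
    raz_elusive_curve ↔
      ((∃ f : ∀ m : ℕ, Fin m → MvPolynomial (Fin 1) ℂ,
          IsPBounded (fun m => Finset.univ.sup fun i : Fin m => (f m i).totalDegree) ∧
            ∃ m₀ : ℕ, ∀ m ≥ m₀, IsElusive (f m) (m - 1) 2) →
        ¬ IsVPFamily (fun n => perPoly (Fin n) ℂ)) := by
  constructor
  · rintro h ⟨f, hdeg, hel⟩
    exact h f (isPolyDefinableMap_id_of_isPBounded_totalDegree f hdeg) hdeg hel
  · intro h f _ hdeg hel
    exact h ⟨f, hdeg, hel⟩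

end Literature.Computability.AlgebraicComplexity

/-! ## Part 2a — arithmetic of the multiset binomials `C(n + j - 1, j)`, rank and growth lemmas -/

open Filter

namespace Literature.Computability.AlgebraicComplexity

/-! ### Multiset binomials `C(n + j - 1, j)` -/

/-- Absorption: `C(n+j, j+1) · (j+1) = C(n+j-1, j) · (n+j)` for `n ≥ 1`. [folklore] -/
theorem choose_multiset_succ_mul_succ {n : ℕ} (hn : 1 ≤ n) (j : ℕ) :
    Nat.choose (n + j) (j + 1) * (j + 1) = Nat.choose (n + j - 1) j * (n + j) := by
  have h := Nat.add_one_mul_choose_eq (n + j - 1) j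
  rw [Nat.sub_add_cancel (by omega : 1 ≤ n + j)] at h
  rw [← h, mul_comm]

/-- `C(n+j, j+1) ≤ n · C(n+j-1, j)` for `n ≥ 1`. [folklore] -/
theorem choose_multiset_succ_le_mul {n : ℕ} (hn : 1 ≤ n) (j : ℕ) :
    Nat.choose (n + j) (j + 1) ≤ n * Nat.choose (n + j - 1) j := by
  refine Nat.le_of_mul_le_mul_right (c := j + 1) ?_ (Nat.succ_pos j)
  rw [choose_multiset_succ_mul_succ hn j, mul_comm n, mul_assoc]
  exact Nat.mul_le_mul_left _ (by nlinarith)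

/-- `C(n+j-1, j) ≤ n^j` for `n ≥ 1`. [folklore] -/
theorem choose_multiset_le_pow {n : ℕ} (hn : 1 ≤ n) : ∀ j : ℕ, Nat.choose (n + j - 1) j ≤ n ^ j
  | 0 => by simp
  | j + 1 => by
    rw [show n + (j + 1) - 1 = n + j by omega, pow_succ']
    exact (choose_multiset_succ_le_mul hn j).trans
      (Nat.mul_le_mul_left n (choose_multiset_le_pow hn j))

/-- `n · C(n+j-1, j) ≤ a · C(n+j, j+1)` for `j + 1 ≤ a`. [folklore] -/
theorem mul_choose_multiset_le_mul_succ {n a j : ℕ} (hja : j + 1 ≤ a) :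
    n * Nat.choose (n + j - 1) j ≤ a * Nat.choose (n + j) (j + 1) := by
  rcases Nat.eq_zero_or_pos n with rfl | hn
  · simp
  calc n * Nat.choose (n + j - 1) j ≤ (n + j) * Nat.choose (n + j - 1) j :=
        Nat.mul_le_mul_right _ (Nat.le_add_right n j)
    _ = (j + 1) * Nat.choose (n + j) (j + 1) := by
        rw [mul_comm, ← choose_multiset_succ_mul_succ hn j, mul_comm]
    _ ≤ a * Nat.choose (n + j) (j + 1) := Nat.mul_le_mul_right _ hja

/-- Iterated: `n^t · C(n+b-1, b) ≤ a^t · C(n+b+t-1, b+t)` for `b + t ≤ a`. [folklore] -/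
theorem pow_mul_choose_multiset_le {n a b : ℕ} :
    ∀ t : ℕ, b + t ≤ a →
      n ^ t * Nat.choose (n + b - 1) b ≤ a ^ t * Nat.choose (n + (b + t) - 1) (b + t)
  | 0, _ => by simp
  | t + 1, h => by
    calc n ^ (t + 1) * Nat.choose (n + b - 1) b
        = n * (n ^ t * Nat.choose (n + b - 1) b) := by ring
      _ ≤ n * (a ^ t * Nat.choose (n + (b + t) - 1) (b + t)) :=
          Nat.mul_le_mul_left n (pow_mul_choose_multiset_le t (by omega))
      _ = a ^ t * (n * Nat.choose (n + (b + t) - 1) (b + t)) := by ring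
      _ ≤ a ^ t * (a * Nat.choose (n + (b + t)) (b + t + 1)) :=
          Nat.mul_le_mul_left _ (mul_choose_multiset_le_mul_succ (by omega))
      _ = a ^ (t + 1) * Nat.choose (n + (b + (t + 1)) - 1) (b + (t + 1)) := by
          rw [show n + (b + (t + 1)) - 1 = n + (b + t) by omega,
            show b + (t + 1) = b + t + 1 by omega]
          ring

/-- `2 · C(n+j-1, j) ≤ C(n+j, j+1)` for `j + 2 ≤ n`. [folklore] -/
theorem two_mul_choose_multiset_le_succ {n j : ℕ} (hjn : j + 2 ≤ n) :
    2 * Nat.choose (n + j - 1) j ≤ Nat.choose (n + j) (j + 1) := by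
  refine Nat.le_of_mul_le_mul_right (c := j + 1) ?_ (Nat.succ_pos j)
  rw [choose_multiset_succ_mul_succ (by omega : 1 ≤ n) j, mul_comm 2, mul_assoc]
  exact Nat.mul_le_mul_left _ (by omega)

/-- Iterated: `2^t · C(n+b-1, b) ≤ C(n+b+t-1, b+t)` for `b + t + 1 ≤ n`. [folklore] -/
theorem two_pow_mul_choose_multiset_le {n b : ℕ} :
    ∀ t : ℕ, b + t + 1 ≤ n → 2 ^ t * Nat.choose (n + b - 1) b ≤ Nat.choose (n + (b + t) - 1) (b + t)
  | 0, _ => by simp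
  | t + 1, h => by
    calc 2 ^ (t + 1) * Nat.choose (n + b - 1) b
        = 2 * (2 ^ t * Nat.choose (n + b - 1) b) := by ring
      _ ≤ 2 * Nat.choose (n + (b + t) - 1) (b + t) :=
          Nat.mul_le_mul_left 2 (two_pow_mul_choose_multiset_le t (by omega))
      _ ≤ Nat.choose (n + (b + t)) (b + t + 1) := two_mul_choose_multiset_le_succ (by omega)
      _ = Nat.choose (n + (b + (t + 1)) - 1) (b + (t + 1)) := by
          rw [show n + (b + (t + 1)) - 1 = n + (b + t) by omega,
            show b + (t + 1) = b + t + 1 by omega]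

/-- `2^n ≤ C(2n-1, n)` for `n ≥ 4` (so a curve family with `m ≤ 2ⁿ` fits into Raz's binomial
arity `C(n+r-1, r)` with `r ≤ n`). [folklore] -/
theorem two_pow_le_choose_multiset_self {n : ℕ} (hn : 4 ≤ n) :
    2 ^ n ≤ Nat.choose (n + n - 1) n := by
  obtain ⟨k, rfl⟩ : ∃ k, n = k + 2 := ⟨n - 2, by omega⟩
  have h1 := two_pow_mul_choose_multiset_le (n := k + 2) (b := 1) k (by omega)
  have h2 := mul_choose_multiset_le_mul_succ (n := k + 2) (a := k + 2) (j := k + 1) le_rfl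
  have e1 : k + 2 + 1 - 1 = k + 2 := by omega
  have e2 : k + 2 + (1 + k) - 1 = 2 * k + 2 := by omega
  have e3 : 1 + k = k + 1 := by omega
  have e4 : k + 2 + (k + 1) - 1 = 2 * k + 2 := by omega
  have e5 : k + 2 + (k + 1) = k + 2 + (k + 2) - 1 := by omega
  rw [e1, e2, e3, Nat.choose_one_right] at h1
  rw [e4, e5] at h2
  have h3 := Nat.le_of_mul_le_mul_left h2 (by omega : 0 < k + 2)
  calc 2 ^ (k + 2) = 2 ^ k * 4 := by rw [pow_add]; norm_num
    _ ≤ 2 ^ k * (k + 2) := Nat.mul_le_mul_left _ (by omega)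
    _ ≤ _ := h1.trans h3

/-! ### Growth lemmas -/

/-- Polynomial versus exponential growth: `C · t^d < 2^t` for all large `t`. [folklore] -/
theorem eventually_mul_pow_lt_two_pow (d C : ℕ) : ∃ T : ℕ, ∀ t ≥ T, C * t ^ d < 2 ^ t := by
  have ht := tendsto_pow_const_div_const_pow_of_one_lt d (show (1 : ℝ) < 2 by norm_num)
  have hev : ∀ᶠ t : ℕ in atTop, (t : ℝ) ^ d / 2 ^ t < 1 / (C + 1) :=
    ht.eventually (gt_mem_nhds (by positivity))
  obtain ⟨T, hT⟩ := eventually_atTop.1 hev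
  refine ⟨T, fun t hts => ?_⟩
  have h := hT t hts
  rw [div_lt_div_iff₀ (by positivity) (by positivity), one_mul] at h
  have h' : ((C * t ^ d : ℕ) : ℝ) < ((2 ^ t : ℕ) : ℝ) := by
    push_cast
    calc (C : ℝ) * (t : ℝ) ^ d ≤ (t : ℝ) ^ d * (C + 1) := by
          nlinarith [pow_nonneg (Nat.cast_nonneg t : (0:ℝ) ≤ t) d]
      _ < 2 ^ t := h
  exact_mod_cast h'

/-- A choice of Raz's rank parameter: for every arity function `m` there is `r : ℕ → ℕ` with
`r n ≥ 3` the least `j ≥ 3` such that `m n ≤ C(n+j-1, j)` whenever some such `j` exists.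
[folklore] -/
theorem exists_rank_function (m : ℕ → ℕ) :
    ∃ r : ℕ → ℕ, (∀ n, 3 ≤ r n) ∧
      (∀ n j, 3 ≤ j → m n ≤ Nat.choose (n + j - 1) j →
          r n ≤ j ∧ m n ≤ Nat.choose (n + r n - 1) (r n)) ∧
        (∀ n j, 3 ≤ j → j < r n → Nat.choose (n + j - 1) j < m n) := by
  classical
  let P : ℕ → ℕ → Prop := fun n j => m n ≤ Nat.choose (n + (j + 3) - 1) (j + 3)
  let r : ℕ → ℕ := fun n => if h : ∃ j, P n j then Nat.find h + 3 else 3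
  refine ⟨r, fun n => ?_, fun n j hj hmj => ?_, fun n j hj hjr => ?_⟩
  · simp only [r]
    split_ifs <;> omega
  · have hP : P n (j - 3) := by
      change m n ≤ Nat.choose (n + (j - 3 + 3) - 1) (j - 3 + 3)
      rw [Nat.sub_add_cancel hj]
      exact hmj
    have hex : ∃ j, P n j := ⟨j - 3, hP⟩
    have hr : r n = Nat.find hex + 3 := by simp only [r, dif_pos hex]
    refine ⟨?_, ?_⟩
    · rw [hr]
      have := Nat.find_min' hex hP
      omega
    · rw [hr]
      exact Nat.find_spec hex
  · by_cases hex : ∃ j, P n j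
    · have hr : r n = Nat.find hex + 3 := by simp only [r, dif_pos hex]
      have hlt : j - 3 < Nat.find hex := by omega
      have := Nat.find_min hex hlt
      change ¬ (m n ≤ Nat.choose (n + (j - 3 + 3) - 1) (j - 3 + 3)) at this
      rw [Nat.sub_add_cancel hj] at this
      exact not_le.1 this
    · have hr : r n = 3 := by simp only [r, dif_neg hex]
      omega

/-- For `n ≥ 2` an admissible rank exists: `m ≤ C(n + j - 1, j)` with `j = max 3 m`. [folklore] -/
theorem le_choose_multiset_max (m n : ℕ) (hn : 2 ≤ n) :
    m ≤ Nat.choose (n + max 3 m - 1) (max 3 m) := by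
  calc m ≤ max 3 m + 1 := by omega
    _ = Nat.choose (max 3 m + 1) (max 3 m) := (Nat.choose_succ_self_right _).symm
    _ ≤ Nat.choose (n + max 3 m - 1) (max 3 m) := Nat.choose_le_choose _ (by omega)

/-- The rank tends to infinity when `m` is super-polynomial. [folklore] -/
theorem rank_eventually_ge (m r : ℕ → ℕ) (hm : ∀ c : ℕ, ∃ n₀, ∀ n ≥ n₀, n ^ c ≤ m n)
    (hr : ∀ n j, 3 ≤ j → m n ≤ Nat.choose (n + j - 1) j →
      r n ≤ j ∧ m n ≤ Nat.choose (n + r n - 1) (r n)) (R : ℕ) :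
    ∃ n₀, ∀ n ≥ n₀, R ≤ r n := by
  obtain ⟨n₀, h₀⟩ := hm R
  refine ⟨max n₀ 2, fun n hn => ?_⟩
  have hn2 : 2 ≤ n := (le_max_right _ _).trans hn
  have hM := (hr n (max 3 (m n)) (le_max_left _ _) (le_choose_multiset_max (m n) n hn2)).2
  have h1 : n ^ R ≤ n ^ r n :=
    (h₀ n ((le_max_left _ _).trans hn)).trans (hM.trans (choose_multiset_le_pow (by omega) _))
  exact (Nat.pow_le_pow_iff_right hn2).1 h1

/-- **Growth condition of Cor. 5.8 for the minimal rank.** With `r n` minimal such that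
`m n ≤ C(n + r n - 1, r n)` (and `r n ≤ n` eventually, `r n → ∞`), for every `c`:
`n^c · C(n + r' - 1, r') ≤ m n - 1` eventually, `r' = ⌊2 r / 3⌋`. [folklore] -/
theorem rank_growth (m r : ℕ → ℕ)
    (hmin : ∀ n j, 3 ≤ j → j < r n → Nat.choose (n + j - 1) j < m n)
    (hrn : ∃ n₀, ∀ n ≥ n₀, r n ≤ n) (hR : ∀ R : ℕ, ∃ n₀, ∀ n ≥ n₀, R ≤ r n) (c : ℕ) :
    ∃ n₀, ∀ n ≥ n₀, n ^ c * Nat.choose (n + 2 * r n / 3 - 1) (2 * r n / 3) ≤ m n - 1 := by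
  obtain ⟨T, hT⟩ := eventually_mul_pow_lt_two_pow (2 * c) (25 ^ c)
  obtain ⟨n₁, h₁⟩ := hrn
  obtain ⟨n₂, h₂⟩ := hR (max (6 * c + 4) (3 * T + 6))
  refine ⟨max (max n₁ n₂) 1, fun n hn => ?_⟩
  have hn₁ : r n ≤ n := h₁ n (by omega)
  have hRle : max (6 * c + 4) (3 * T + 6) ≤ r n := h₂ n (by omega)
  have hn1 : 1 ≤ n := by omega
  -- a = r - 1, b = 2r/3, t = a - b
  set b := 2 * r n / 3 with hb
  obtain ⟨t, ht⟩ : ∃ t, b + t = r n - 1 := ⟨r n - 1 - b, by omega⟩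
  have ht2c : 2 * c ≤ t := by omega
  have htT : T ≤ t := by omega
  have ht1 : 1 ≤ t := by omega
  have hlt : Nat.choose (n + (b + t) - 1) (b + t) < m n := hmin n (b + t) (by omega) (by omega)
  suffices hs : n ^ c * Nat.choose (n + b - 1) b ≤ Nat.choose (n + (b + t) - 1) (b + t) by omega
  by_cases hcase : (b + t) * (b + t) ≤ n
  · -- Case 1: `a² ≤ n`; use `n^t C_b ≤ a^t C_a` and `a^t ≤ n^(t-c)`.
    have hA := pow_mul_choose_multiset_le (n := n) (a := b + t) (b := b) t le_rfl
    have hat : (b + t) ^ t ≤ n ^ (t - c) := by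
      rw [← Nat.pow_le_pow_iff_left (show (2 : ℕ) ≠ 0 by decide), ← pow_mul, ← pow_mul]
      calc (b + t) ^ (t * 2) = ((b + t) * (b + t)) ^ t := by rw [mul_comm t 2, pow_mul, pow_two]
        _ ≤ n ^ t := Nat.pow_le_pow_left hcase t
        _ ≤ n ^ ((t - c) * 2) := Nat.pow_le_pow_right hn1 (by omega)
    have hpos : 0 < (b + t) ^ t := Nat.pow_pos (by omega)
    refine Nat.le_of_mul_le_mul_right (c := (b + t) ^ t) ?_ hpos
    calc n ^ c * Nat.choose (n + b - 1) b * (b + t) ^ t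
        ≤ n ^ c * Nat.choose (n + b - 1) b * n ^ (t - c) := Nat.mul_le_mul_left _ hat
      _ = n ^ t * Nat.choose (n + b - 1) b := by
          rw [mul_comm, ← mul_assoc, ← pow_add, show t - c + c = t by omega]
      _ ≤ (b + t) ^ t * Nat.choose (n + (b + t) - 1) (b + t) := hA
      _ = Nat.choose (n + (b + t) - 1) (b + t) * (b + t) ^ t := mul_comm _ _
  · -- Case 2: `n < a²`; use `2^t C_b ≤ C_a` and `n^c ≤ 25^c t^(2c) < 2^t`.
    push Not at hcase
    have hB := two_pow_mul_choose_multiset_le (n := n) (b := b) t (by omega)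
    have ha : b + t ≤ 5 * t := by omega
    have hnc : n ^ c ≤ 2 ^ t := by
      calc n ^ c ≤ ((5 * t) * (5 * t)) ^ c :=
            Nat.pow_le_pow_left (hcase.le.trans (Nat.mul_le_mul ha ha)) c
        _ = 25 ^ c * t ^ (2 * c) := by ring
        _ ≤ 2 ^ t := (hT t htT).le
    calc n ^ c * Nat.choose (n + b - 1) b ≤ 2 ^ t * Nat.choose (n + b - 1) b :=
          Nat.mul_le_mul_right _ hnc
      _ ≤ _ := hB

end Literature.Computability.AlgebraicComplexity

/-! ## Part 2b — the abstract's curve statement from Cor. 5.8 (padding to binomial arity) -/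

namespace Literature.Computability.AlgebraicComplexity

open MvPolynomial

universe u

/-! ### p-boundedness ignores finitely many values -/

/-- A function eventually dominated by a p-bounded function is p-bounded. [folklore] -/
theorem IsPBounded.of_eventually_le {s t : ℕ → ℕ} (n₀ : ℕ) (ht : IsPBounded t)
    (h : ∀ n, n₀ ≤ n → s n ≤ t n) : IsPBounded s := by
  obtain ⟨a, b, hab⟩ := (IsPBounded.iff_exists_le_mul_succ_pow t).1 ht
  refine (IsPBounded.iff_exists_le_mul_succ_pow s).2
    ⟨a + ∑ j ∈ Finset.range n₀, s j, b, fun n => ?_⟩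
  have hpow : 1 ≤ (n + 1) ^ b := Nat.one_le_pow _ _ (Nat.succ_pos n)
  rcases Nat.lt_or_ge n n₀ with hn | hn
  · have hs : s n ≤ ∑ j ∈ Finset.range n₀, s j :=
      Finset.single_le_sum (f := s) (fun _ _ => Nat.zero_le _) (Finset.mem_range.2 hn)
    calc s n ≤ (a + ∑ j ∈ Finset.range n₀, s j) * 1 := by omega
      _ ≤ (a + ∑ j ∈ Finset.range n₀, s j) * (n + 1) ^ b := Nat.mul_le_mul_left _ hpow
  · calc s n ≤ a * (n + 1) ^ b := (h n hn).trans (hab n)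
      _ ≤ (a + ∑ j ∈ Finset.range n₀, s j) * (n + 1) ^ b :=
          Nat.mul_le_mul_right _ (Nat.le_add_right _ _)

/-! ### Arity bound: an `(m-1, 2)`-elusive curve of degree `< D` has `m ≤ D` -/

section ArityBound

variable {k : Type*} [CommRing k]

/-- Evaluating a one-variable polynomial of degree `< D`: `p(a) = Σ_{e<D} coeff_e(p) · a^e`.
[folklore] -/
theorem eval_eq_sum_range_of_totalDegree_lt (p : MvPolynomial (Fin 1) k) {D : ℕ}
    (hD : p.totalDegree < D) (x : Fin 1 → k) :
    eval x p = ∑ e ∈ Finset.range D, coeff (Finsupp.single 0 e) p * x 0 ^ e := by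
  obtain ⟨D', rfl⟩ : ∃ D', D = D' + 1 := ⟨D - 1, by omega⟩
  conv_lhs => rw [eq_sum_range_of_totalDegree_le p (Nat.lt_succ_iff.1 hD)]
  rw [map_sum]
  refine Finset.sum_congr rfl fun e _ => ?_
  rw [map_mul, eval_C, map_pow, eval_X]

/-- A curve of degree `< D` lies in the image of the LINEAR map `kᴰ → k^ι`,
`y ↦ (Σ_{e<D} coeff_e(f_i) · y_e)_i` (take `y_e = a^e`). [folklore] -/
theorem range_polyMapEval_subset_linear {ι : Type*} {D : ℕ} (f : ι → MvPolynomial (Fin 1) k)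
    (hf : ∀ i, (f i).totalDegree < D) :
    Set.range (polyMapEval f) ⊆ Set.range (polyMapEval fun i =>
      ∑ e : Fin D, C (coeff (Finsupp.single 0 (e : ℕ)) (f i)) * X e) := by
  rintro _ ⟨x, rfl⟩
  refine ⟨fun e => x 0 ^ (e : ℕ), funext fun i => ?_⟩
  rw [polyMapEval_apply, polyMapEval_apply, eval_eq_sum_range_of_totalDegree_lt (f i) (hf i) x,
    map_sum, Finset.sum_range (fun e => coeff (Finsupp.single 0 e) (f i) * x 0 ^ e)]
  refine Finset.sum_congr rfl fun e _ => ?_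
  rw [map_mul, eval_C, eval_X]

/-- **Arity bound.** If a curve `f : k → k^m` with all coordinates of degree `< D` is
`(m - 1, 2)`-elusive, then `m ≤ D`: otherwise the linear map of
`range_polyMapEval_subset_linear` on `D ≤ m - 1` variables covers it. [folklore] -/
theorem le_of_isElusive_of_totalDegree_lt {m D : ℕ} {f : Fin m → MvPolynomial (Fin 1) k}
    (hel : IsElusive f (m - 1) 2) (hf : ∀ i, (f i).totalDegree < D) : m ≤ D := by
  by_contra h
  have hD : D ≤ m - 1 := by omega
  have hX : ∀ e : Fin D, (X e : MvPolynomial (Fin D) k).totalDegree ≤ 1 := fun e =>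
    (totalDegree_monomial_le _ _).trans (by simp)
  refine (hel.anti_left hD)
    (fun i => ∑ e : Fin D, C (coeff (Finsupp.single 0 (e : ℕ)) (f i)) * X e)
    (fun i => ?_) (range_polyMapEval_subset_linear f hf)
  refine (totalDegree_finsetSum _ _).trans (Finset.sup_le fun e _ => ?_)
  refine (totalDegree_mul _ _).trans ?_
  rw [totalDegree_C, zero_add]
  exact (hX e).trans one_le_two

end ArityBound

/-! ### Padding a tuple preserves elusiveness -/

section Padding

variable {k : Type*} [CommSemiring k]

/-- Elusiveness passes from a tuple `f` to any tuple `f'` containing it (`f' ∘ e = f` for some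
reindexing `e`, not necessarily injective): a cover of `Image f'` by `Γ` restricts to a cover of
`Image f` by `Γ ∘ e`. In particular padding a polynomial mapping with extra coordinates keeps it
`(s, r)`-elusive. [folklore] -/
theorem IsElusive.of_comp {ι₁ ι₂ : Type*} {σ' : Type*} {f : ι₁ → MvPolynomial σ' k}
    {f' : ι₂ → MvPolynomial σ' k} {s r : ℕ} (h : IsElusive f s r) (e : ι₁ → ι₂)
    (hf : ∀ i, f' (e i) = f i) : IsElusive f' s r := by
  intro Γ hΓ hsub
  refine h (fun i => Γ (e i)) (fun i => hΓ (e i)) ?_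
  rintro _ ⟨x, rfl⟩
  obtain ⟨y, hy⟩ := hsub (Set.mem_range_self x)
  refine ⟨y, funext fun i => ?_⟩
  have := congr_fun hy (e i)
  simp only [polyMapEval_apply] at this ⊢
  rw [this, hf]

/-- Re-indexing the `w`-variables of Def. 1.3 along `Fin k ↪ Fin k'` (`k ≤ k'`) commutes with
the bit substitution: the bits `t < k` of `i` are read in the same positions. [folklore] -/
theorem bitSubst_rename_castLE {σ : ℕ → Type*} {K K' : ℕ} (hK : K ≤ K') (n ℓ i : ℕ)
    (p : MvPolynomial ((σ n ⊕ Fin ℓ) ⊕ Fin K) k) :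
    bitSubst n ℓ K' i (rename (Sum.map id (Fin.castLE hK)) p) = bitSubst n ℓ K i p := by
  unfold bitSubst
  rw [aeval_rename]
  refine congrArg (fun φ : (σ n ⊕ Fin ℓ) ⊕ Fin K → MvPolynomial (σ n ⊕ Fin ℓ) k => aeval φ p)
    (funext fun v => ?_)
  rcases v with a | t
  · rfl
  · simp

/-- The bit substitution fixes polynomials not involving the `w`-variables. [folklore] -/
theorem bitSubst_rename_inl {σ : ℕ → Type*} (n ℓ K i : ℕ)
    (p : MvPolynomial (σ n ⊕ Fin ℓ) k) :
    bitSubst n ℓ K i (rename Sum.inl p) = p := by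
  unfold bitSubst
  rw [aeval_rename, Sum.elim_comp_inl, aeval_X_left_apply]

end Padding

/-! ### `Raz2010_cor_5_8` ⇒ `Raz2010_elusive_curve` -/

/-- **The abstract's curve statement from Cor. 5.8** (Raz 2010, Cor. 5.8 = Cor. 1.14, read
through Prop. 1.2 and p. 137): `Raz2010_cor_5_8 F → Raz2010_elusive_curve F`.

Proof (Raz's parameters made explicit). Given an explicit curve family `f n : F → F^{m(n)}` of
degree `< 2ⁿ`, `m ≥ n^{ω(1)}`, eventually `(m-1, 2)`-elusive: (i) `m n ≤ 2ⁿ` for large `n`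
(`le_of_isElusive_of_totalDegree_lt`), so the least `r = r(n) ≥ 3` with
`C(n+r-1, r) ≥ m(n)` satisfies `r ≤ n` (`two_pow_le_choose_multiset_self`) and `r → ∞`
(`rank_eventually_ge`, as `C(n+r-1, r) ≤ nʳ`); (ii) pad the multilinearised curve
`f̂ n : Fⁿ → F^{m(n)}` (Prop. 1.2) to `m' = C(n+r-1, r)` coordinates by Raz's own formula
`i ↦ Σ_e g_n(x, e, bits(i))` for ALL `i < m'` — this keeps Def. 1.3 with the same `g_n`
(re-indexed `w`-variables, `bitSubst_rename_castLE`) and keeps `(m-1, 2)`-elusiveness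
(`IsElusive.multilinearize`, `IsElusive.of_comp`); (iii) with `s = m - 1`, minimality of `r`
gives the growth hypothesis `s / C(n+r'-1, r') ≥ n^{ω(1)}`, `r' = ⌊2r/3⌋` (`rank_growth`), and
`3 ≤ r ≤ n ≤ s` holds eventually; Cor. 5.8 (over the extension `G = F`) concludes.
[cite: Raz2010, Cor. 5.8 (p. 172), Prop. 1.2, p. 137] -/
theorem Raz2010_elusive_curve_of_cor_5_8 {F : Type u} [Field F] (h : Raz2010_cor_5_8 F) :
    Raz2010_elusive_curve F := by
  intro hF m f hm hdeg hexp hel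
  classical
  obtain ⟨r, hr3, hrmin, hrlt⟩ := exists_rank_function m
  obtain ⟨ℓ, g, hℓ, hgdeg, hgcx, hgid⟩ := hexp
  obtain ⟨n₀, h₀⟩ := hel
  obtain ⟨n₂, h₂⟩ := hdeg
  -- (i) arity bound and admissibility of `r n ≤ n`
  have hm2 : ∀ n, max n₀ n₂ ≤ n → m n ≤ 2 ^ n := fun n hn =>
    le_of_isElusive_of_totalDegree_lt (h₀ n (le_of_max_le_left hn))
      (h₂ n (le_of_max_le_right hn))
  have hadm : ∀ n, max (max n₀ n₂) 4 ≤ n →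
      r n ≤ n ∧ m n ≤ Nat.choose (n + r n - 1) (r n) := fun n hn =>
    hrmin n n (by have := le_of_max_le_right hn; omega)
      ((hm2 n (le_of_max_le_left hn)).trans
        (two_pow_le_choose_multiset_self (le_of_max_le_right hn)))
  have hmM : ∀ n, 2 ≤ n → m n ≤ Nat.choose (n + r n - 1) (r n) := fun n hn =>
    (hrmin n _ (le_max_left _ _) (le_choose_multiset_max (m n) n hn)).2
  -- (ii)/(iii): apply Cor. 5.8 to the padded multilinearised family
  refine h hF r (fun n => m n - 1)
    (fun n i => boolSum (bitSubst n (ℓ n) (Nat.clog 2 (m n)) i (g n))) ?_ ?_ ?_ ?_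
  · -- `3 ≤ r ≤ n ≤ s` eventually
    obtain ⟨n₁, h₁⟩ := hm 2
    refine ⟨max (max (max n₀ n₂) 4) n₁, fun n hn => ⟨hr3 n, (hadm n (le_of_max_le_left hn)).1, ?_⟩⟩
    have hsq : n ^ 2 ≤ m n := h₁ n (le_of_max_le_right hn)
    have h4 : 4 ≤ n := le_of_max_le_right (le_of_max_le_left hn)
    have : n + 1 ≤ n ^ 2 := by nlinarith
    show n ≤ m n - 1
    omega
  · -- growth: `n^c · C(n + r' - 1, r') ≤ s n` eventually
    exact rank_growth m r hrlt ⟨_, fun n hn => (hadm n hn).1⟩ (rank_eventually_ge m r hm hrmin)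
  · -- Def. 1.3 for the padded family, with the same `ℓ` and `g` (re-indexed `w`-variables)
    refine ⟨ℓ, fun n => if hle : m n ≤ Nat.choose (n + r n - 1) (r n) then
        rename (Sum.map id (Fin.castLE (Nat.clog_mono_right 2 hle))) (g n)
      else rename Sum.inl (bitSubst n (ℓ n) (Nat.clog 2 (m n)) 0 (g n)), hℓ, ?_, ?_, ?_⟩
    · refine IsPBounded.of_eventually_le 2 hgdeg fun n hn => ?_
      simp only [dif_pos (hmM n hn)]
      exact totalDegree_rename_le _ _
    · refine IsPBounded.of_eventually_le 2 hgcx fun n hn => ?_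
      simp only [dif_pos (hmM n hn)]
      exact complexity_rename_le_holds' _ _
    · intro n i
      by_cases hle : m n ≤ Nat.choose (n + r n - 1) (r n)
      · simp only [dif_pos hle, bitSubst_rename_castLE]
      · -- only `n ≤ 1` can fail admissibility; then the arity is `≤ 1` and `i = 0`
        have hn : n < 2 := not_le.1 fun hn => hle (hmM n hn)
        have hM : Nat.choose (n + r n - 1) (r n) ≤ 1 := by
          have h3 := hr3 n
          rcases (show n = 0 ∨ n = 1 by omega) with rfl | rfl
          · rw [Nat.choose_eq_zero_of_lt (by omega)]
            exact Nat.zero_le _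
          · rw [show 1 + r 1 - 1 = r 1 by omega, Nat.choose_self]
        have hi2 : (i : ℕ) < Nat.choose (n + r n - 1) (r n) := i.2
        have hi : (i : ℕ) = 0 := by omega
        simp only [dif_neg hle, bitSubst_rename_inl, hi]
  · -- elusiveness of the padded family over `G = F`
    refine ⟨max (max n₀ n₂) 4, fun n hn => exists_extension_isElusive_of_isElusive ?_⟩
    have hle := (hadm n hn).2
    refine ((h₀ n (le_of_max_le_left (le_of_max_le_left hn))).multilinearize
      (h₂ n (le_of_max_le_right (le_of_max_le_left hn)))).of_comp (Fin.castLE hle) fun i => ?_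
    exact (hgid n i).symm

end Literature.Computability.AlgebraicComplexity
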